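import Literature.MathematicalPhysics.KineticTheory.HardSphereEulerProofs
import Summits.AtomisticToContinuum.HydrodynamicLimit.Theorems.VitaliAmplitudeTransferAmplitudeTransferPathCalculus

/-!
# Amplitude transfer — small tools for the final assembly

* `exists_bounds_of_continuous_pos` — continuous profiles `a₀, θ₀ > 0`, `u₀` on the compact torus lie
  within two-sided bounds `B₀ ≥ 1`;
* `continuous_slices_of_isHardSphereEulerSolution` — time slices of a classical solution are
  continuous;
* `tendstoHydroFieldsAt_congr` — `TendstoHydroFieldsAt` only depends on the time-`t` slices;
* `continuousOn_integral_mul_of_continuousOn_stLift` — continuity in the parameter of tested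
  fields `δ ↦ ∫ χ f_δ` for a family with continuous space–time lift on `[0,1] × ℝ³`;
* `integral_const_T3` — the torus has unit volume.
-/

noncomputable section

open MeasureTheory Filter Set Topology
open scoped ENNReal

namespace Summit.AtomisticToContinuum.HydrodynamicLimit.Theorems.AmplitudeTransfer

open Literature.MathematicalPhysics.KineticTheory Literature.Analysis.FluidPDE
open Literature.Analysis.FunctionSpaces

/-- The torus `𝕋³` carries a probability (Haar) measure: `∫ c = c`. -/
theorem integral_const_T3 (c : ℝ) : ∫ _x : T3, c = c := by
  simp

/-- **Two-sided bounds for continuous positive profiles** on the compact torus. -/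
theorem exists_bounds_of_continuous_pos {a₀ θ₀ : T3 → ℝ} {u₀ : T3 → V3} (ha : Continuous a₀)
    (hθ : Continuous θ₀) (hu : Continuous u₀) (ha0 : ∀ x, 0 < a₀ x) (hθ0 : ∀ x, 0 < θ₀ x) :
    ∃ B₀ : ℝ, 1 ≤ B₀ ∧ ∀ x, B₀⁻¹ ≤ a₀ x ∧ a₀ x ≤ B₀ ∧ B₀⁻¹ ≤ θ₀ x ∧ θ₀ x ≤ B₀ ∧ ‖u₀ x‖ ≤ B₀ := by
  -- upper bounds
  obtain ⟨Ca, -, hCa⟩ := exists_forall_abs_le_of_continuous ha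
  obtain ⟨Cθ, -, hCθ⟩ := exists_forall_abs_le_of_continuous hθ
  obtain ⟨Cu, hCu⟩ := isCompact_univ.exists_bound_of_continuousOn hu.continuousOn
  -- positive lower bounds (minimum on the compact torus)
  obtain ⟨xa, -, hxa⟩ := isCompact_univ.exists_isMinOn univ_nonempty ha.continuousOn
  obtain ⟨xθ, -, hxθ⟩ := isCompact_univ.exists_isMinOn univ_nonempty hθ.continuousOn
  have hma : ∀ x, a₀ xa ≤ a₀ x := fun x => hxa (mem_univ x)
  have hmθ : ∀ x, θ₀ xθ ≤ θ₀ x := fun x => hxθ (mem_univ x)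
  have ha1 : 0 < a₀ xa := ha0 xa
  have hθ1 : 0 < θ₀ xθ := hθ0 xθ
  set B₀ : ℝ := max 1 (max (max Ca Cθ) (max Cu (max (a₀ xa)⁻¹ (θ₀ xθ)⁻¹))) with hB₀
  have h1 : 1 ≤ B₀ := le_max_left _ _
  have hB0 : 0 < B₀ := by linarith
  refine ⟨B₀, h1, fun x => ⟨?_, ?_, ?_, ?_, ?_⟩⟩
  · have : (a₀ xa)⁻¹ ≤ B₀ := by rw [hB₀]; simp
    calc B₀⁻¹ ≤ ((a₀ xa)⁻¹)⁻¹ := by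
          rw [inv_le_inv₀ hB0 (inv_pos.2 ha1)]; exact this
      _ = a₀ xa := inv_inv _
      _ ≤ a₀ x := hma x
  · exact ((le_abs_self _).trans (hCa x)).trans (by rw [hB₀]; simp)
  · have : (θ₀ xθ)⁻¹ ≤ B₀ := by rw [hB₀]; simp
    calc B₀⁻¹ ≤ ((θ₀ xθ)⁻¹)⁻¹ := by
          rw [inv_le_inv₀ hB0 (inv_pos.2 hθ1)]; exact this
      _ = θ₀ xθ := inv_inv _
      _ ≤ θ₀ x := hmθ x
  · exact ((le_abs_self _).trans (hCθ x)).trans (by rw [hB₀]; simp)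
  · exact (hCu x (mem_univ x)).trans (by rw [hB₀]; simp)

/-- **Time slices of a classical solution are continuous.** -/
theorem continuous_slices_of_isHardSphereEulerSolution {σ T : ℝ} {ρ θ : ℝ → T3 → ℝ}
    {u : ℝ → T3 → V3} (h : IsHardSphereEulerSolution σ T ρ u θ) {t : ℝ} (ht : t ∈ Ico 0 T) :
    Continuous (ρ t) ∧ Continuous (u t) ∧ Continuous (θ t) := by
  have key : ∀ {F : Type} [NormedAddCommGroup F] [NormedSpace ℝ F] {f : ℝ → T3 → F},
      Torus.IsSmoothSpaceTimeOn (Ico 0 T) f → Continuous (f t) := by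
    intro F _ _ f hf
    have h1 : Continuous fun y : EuclideanSpace ℝ (Fin 3) => Torus.stLift f (t, y) :=
      hf.continuousOn.comp_continuous (continuous_const.prodMk continuous_id)
        fun y => mk_mem_prod ht (mem_univ y)
    rw [Torus.isOpenQuotientMap_proj.isQuotientMap.continuous_iff]
    exact h1
  exact ⟨key h.smooth_density, key h.smooth_velocity, key h.smooth_temperature⟩

/-- `TendstoHydroFieldsAt` at time `t` only depends on the time-`t` slices of the fields. -/
theorem tendstoHydroFieldsAt_congr {ε : ℕ → ℝ} {P : (N : ℕ) → Measure (Config (N + 1) (Fin 3) T3)}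
    {Φ : (N : ℕ) → HardSphereFlow (Torus.geometry (Fin 3)) (ε N) (N + 1)}
    {ρ θ ρ' θ' : ℝ → T3 → ℝ} {u u' : ℝ → T3 → V3} {t : ℝ}
    (hρ : ρ t = ρ' t) (hu : u t = u' t) (hθ : θ t = θ' t) (h : TendstoHydroFieldsAt P Φ ρ u θ t) :
    TendstoHydroFieldsAt P Φ ρ' u' θ' t := by
  intro χ hχ δ hδ
  have h' := h χ hχ δ hδ
  simp only [hρ, hu, hθ] at h'
  exact h'

/-- A family with continuous space–time lift on `[0,1] × ℝ³` is uniformly bounded there. -/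
theorem exists_bound_of_continuousOn_stLift {f : ℝ → T3 → ℝ}
    (hf : ContinuousOn (Torus.stLift f) (Icc (0 : ℝ) 1 ×ˢ univ)) :
    ∃ M : ℝ, ∀ δ ∈ Icc (0 : ℝ) 1, ∀ x, |f δ x| ≤ M := by
  set Kc : Set (ℝ × EuclideanSpace ℝ (Fin 3)) :=
    Icc (0 : ℝ) 1 ×ˢ {y : EuclideanSpace ℝ (Fin 3) | ∀ i, y i ∈ Icc (0 : ℝ) 1} with hKc
  have hKcpt : IsCompact Kc := isCompact_Icc.prod isCompact_closedCube
  have hKsub : Kc ⊆ Icc (0 : ℝ) 1 ×ˢ univ := prod_mono le_rfl (subset_univ _)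
  obtain ⟨M, hM⟩ := hKcpt.exists_bound_of_continuousOn (hf.mono hKsub)
  refine ⟨M, fun δ hδ x => ?_⟩
  have h := hM (δ, Torus.repr x) (mk_mem_prod hδ (repr_mem_closedCube x))
  simpa [Torus.stLift_apply, Torus.proj_repr, Real.norm_eq_abs] using h

/-- **Continuity in the parameter of tested fields**: if the space–time lift of `δ ↦ f_δ` is
continuous on `[0,1] × ℝ³`, then `δ ↦ ∫ χ f_δ` is continuous on `[0,1]` for continuous `χ`. -/
theorem continuousOn_integral_mul_of_continuousOn_stLift {f : ℝ → T3 → ℝ} {χ : T3 → ℝ}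
    (hf : ContinuousOn (Torus.stLift f) (Icc (0 : ℝ) 1 ×ˢ univ)) (hχ : Continuous χ) :
    ContinuousOn (fun δ => ∫ x, χ x * f δ x) (Icc (0 : ℝ) 1) := by
  obtain ⟨C, -, hC⟩ := exists_forall_abs_le_of_continuous hχ
  obtain ⟨M, hM⟩ := exists_bound_of_continuousOn_stLift hf
  refine continuousOn_of_dominated (bound := fun _ => C * M) ?_ ?_ (integrable_const _) ?_
  · intro δ hδ
    exact (hχ.mul (continuous_slice_of_continuousOn_stLift hf hδ)).aestronglyMeasurable
  · intro δ hδ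
    refine Eventually.of_forall fun x => ?_
    rw [Real.norm_eq_abs, abs_mul]
    exact mul_le_mul (hC x) (hM δ hδ x) (abs_nonneg _) ((abs_nonneg _).trans (hC x))
  · refine Eventually.of_forall fun x => ?_
    exact continuousOn_const.mul (continuousOn_param_of_continuousOn_stLift hf x)

end Summit.AtomisticToContinuum.HydrodynamicLimit.Theorems.AmplitudeTransfer

end
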